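import Summits.QuantumFields.YangMills.Theorems.BalabanUVNodesPortS1G3CParamRecord
import Summits.QuantumFields.YangMills.Theorems.BalabanUVNodesPortS1G3COpNorm
import Summits.QuantumFields.YangMills.Theorems.BalabanUVNodesPortS1LocPowSeries

/-!
# NODE O port PT-A — `stub_G3C` (repaired edition `G3CAtRecordL`), layer (D3a): THE REMAINDER AS A SUM OF ELEMENTARY STEPS `S_{□,Y} := T_Y·P_□̃·G_□·𝟙_□` over the pieces `Y` sticking out
# of `□̃`, and the OPERATOR-NORM letters of its factors — `‖P_Z‖, ‖𝟙_□‖ ≤ 1`, `‖ext M‖ ≤ ‖M‖`, `‖G_Z(x,φ)‖ ≤ 1/γ₀` (x-uniform), `‖T_Y(φ)‖ ≤ c₀e^{−δ₀d_j(Y)}` — hence the FAR-STEP BOUND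
# `‖S_{□,Y}(x,φ)‖ ≤ c₀e^{−δ₀d_j(Y)}/γ₀` with NO index count (memo §5b; the near-step bound with the lattice factor `e^{−κLMc}` is layer (D3b))

Cell `ym-nodeO-ideate`, porter hand `hand-27930-G3C` (g0); DEFINITION file (`g3cStep`) + letters; `--supports stmt-QuantumFields-27930 --as helper`; count-neutral.
[B9] = [Balaban1985BackgroundPropagators], [16] = [Balaban1985UV3], [I] = [Balaban1987RG1].

WHAT THIS FILE PROVES (sorry-free): `nonB0Block_eq_sum` (`nonB0Block (TC φ) = Σ_Y nonB0Block (T_Y φ)`, (P4)), `g3cLocOp_eq_sum_nonB0Block`, `g3cLocOp_mul_proj`, ★ `g3cE_eq_sum`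
(`E_□ = Σ_{Y ⊄ □̃} T_Y·P_□̃`), def `g3cStep`, ★ `g3cR_eq_sum_step` (`R = Σ_□ Σ_{Y ⊄ □̃} S_{□,Y}`); generic `G3CCT.l2_opNorm_diagonal_le` (diagonal with entries of norm `≤ 1`),
`G3CInv.l2_opNorm_extend_le`; `l2_opNorm_g3cProj_le`, `l2_opNorm_g3cInd_le`, ★ `l2_opNorm_g3cLocInv_le` (`≤ 1/γ₀`), `l2_opNorm_nonB0Block_TY_le` (`≤ c₀e^{−δ₀d_j(Y)}`),
★ `l2_opNorm_g3cStep_le_far` (`≤ c₀e^{−δ₀d_j(Y)}/γ₀`).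

HONEST FRAMING.  Algebra + elementary operator-norm bounds under the HYPOTHESIS `P0CarrierClauses …` (inhabited nowhere); nothing of Bałaban's estimates asserted, ported or discharged; `stub_G3C`
NOT closed; 27930 OPEN; NODE O 0∕1; COUNT 8∕28 · K 1∕4 UNMOVED; finite `𝕋⁴_{L^K}` at fixed ε — NOT continuum ∕ OS ∕ Clay; **the Yang–Mills mass gap is NOT proved by any of this.**  No `sorry`,
no `instance`, no `notation`; standard axioms.
-/

noncomputable section

open scoped BigOperators Matrix.Norms.L2Operator Topology Matrix Classical
open Filter Finset WithLp

namespace Summit.QuantumFields.YangMills.Theorems.BalabanUVNodesPortS1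

open Summit.QuantumFields.YangMills.Theorems.K0RecordFormatNames
open Literature.MathematicalPhysics.QuantumFieldTheory.Balaban1983to89
open Literature.MathematicalPhysics.QuantumFieldTheory.Balaban1983to89.Node00
open Literature.MathematicalPhysics.QuantumFieldTheory.Balaban1983to89.T4Continuum (T4Family)
open Literature.MathematicalPhysics.QuantumFieldTheory.Balaban1983to89.TreeLengthTorus (TPt)
open Literature.MathematicalPhysics.QuantumFieldTheory.Balaban1983to89.B5Prop11Lower (nsq nsq_nonneg)

/-! ## §1  Generic operator-norm letters: 0/1 diagonals, extensions by zero -/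

namespace G3CCT

variable {ι : Type*} [Fintype ι] [DecidableEq ι]

/-- A diagonal matrix whose entries have norm `≤ 1` has `ℓ²`-operator norm `≤ 1`. [folklore] -/
theorem l2_opNorm_diagonal_le (f : ι → ℂ) (hf : ∀ i, ‖f i‖ ≤ 1) : ‖Matrix.diagonal f‖ ≤ 1 := by
  refine l2_opNorm_le_of_row_col_sum _ zero_le_one (fun i => ?_) (fun j => ?_)
  · rw [Finset.sum_eq_single i (fun j _ hji => by rw [Matrix.diagonal_apply_ne _ (Ne.symm hji), norm_zero]) (fun h => absurd (Finset.mem_univ i) h),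
      Matrix.diagonal_apply_eq]
    exact hf i
  · rw [Finset.sum_eq_single j (fun i _ hij => by rw [Matrix.diagonal_apply_ne _ hij, norm_zero]) (fun h => absurd (Finset.mem_univ j) h),
      Matrix.diagonal_apply_eq]
    exact hf j

end G3CCT

namespace G3CInv

variable {ι : Type*} [Fintype ι] [DecidableEq ι]

/-- **Extension by zero does not increase the `ℓ²`-operator norm**: `‖ext M‖ ≤ ‖M‖`. [folklore] -/
theorem l2_opNorm_extend_le {p : ι → Prop} [DecidablePred p] (M : Matrix {i // p i} {i // p i} ℂ) :
    ‖(Matrix.of fun i j : ι => if hi : p i then (if hj : p j then M ⟨i, hi⟩ ⟨j, hj⟩ else 0) else 0)‖ ≤ ‖M‖ := by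
  set E : Matrix ι ι ℂ := Matrix.of fun i j : ι => if hi : p i then (if hj : p j then M ⟨i, hi⟩ ⟨j, hj⟩ else 0) else 0 with hE
  refine Literature.Analysis.InnerProduct.l2_opNorm_le_of_forall_norm_mulVec_le E (norm_nonneg _) fun v => ?_
  -- the restriction of `v` to the block
  set w : EuclideanSpace ℂ {i // p i} := (EuclideanSpace.equiv {i // p i} ℂ).symm (fun i => (ofLp v) i.1) with hw
  have hEv : ∀ i, (E *ᵥ ofLp v) i = if hi : p i then (M *ᵥ ofLp w) ⟨i, hi⟩ else 0 := by
    intro i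
    rw [Matrix.mulVec, dotProduct]
    by_cases hi : p i
    · rw [dif_pos hi, Matrix.mulVec, dotProduct]
      rw [← Fintype.sum_subtype_add_sum_subtype p (fun j => E i j * ofLp v j)]
      rw [Finset.sum_eq_zero (s := (Finset.univ : Finset {j // ¬ p j})) (fun j _ => by
        rw [hE, Matrix.of_apply, dif_pos hi, dif_neg j.2, zero_mul]), add_zero]
      refine Finset.sum_congr rfl fun j _ => ?_
      rw [hE, Matrix.of_apply, dif_pos hi, dif_pos j.2]
      rfl
    · rw [dif_neg hi]
      exact Finset.sum_eq_zero fun j _ => by rw [hE, Matrix.of_apply, dif_neg hi, zero_mul]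
  -- norms: ‖E v‖ = ‖M w‖ and ‖w‖ ≤ ‖v‖
  have hn1 : ‖(toLp 2 (E *ᵥ ofLp v) : EuclideanSpace ℂ ι)‖ = ‖(EuclideanSpace.equiv {i // p i} ℂ).symm (M *ᵥ ofLp w)‖ := by
    rw [EuclideanSpace.norm_eq, EuclideanSpace.norm_eq]
    congr 1
    rw [← Fintype.sum_subtype_add_sum_subtype p (fun i => ‖(toLp 2 (E *ᵥ ofLp v) : EuclideanSpace ℂ ι) i‖ ^ 2)]
    rw [Finset.sum_eq_zero (s := (Finset.univ : Finset {j // ¬ p j})) (fun i _ => by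
      rw [PiLp.toLp_apply, hEv, dif_neg i.2, norm_zero]; ring), add_zero]
    refine Finset.sum_congr rfl fun i _ => ?_
    rw [PiLp.toLp_apply, hEv, dif_pos i.2]
    rfl
  have hn2 : ‖w‖ ≤ ‖v‖ := by
    rw [EuclideanSpace.norm_eq, EuclideanSpace.norm_eq]
    apply Real.sqrt_le_sqrt
    rw [← Fintype.sum_subtype_add_sum_subtype p (fun i => ‖v i‖ ^ 2)]
    have e : ∑ i : {i // p i}, ‖w i‖ ^ 2 = ∑ i : {i // p i}, ‖v i.1‖ ^ 2 := Finset.sum_congr rfl fun i _ => rfl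
    rw [e]
    exact le_add_of_nonneg_right (Finset.sum_nonneg fun i _ => by positivity)
  rw [hn1]
  exact (Matrix.l2_opNorm_mulVec M w).trans (mul_le_mul_of_nonneg_left hn2 (norm_nonneg _))

end G3CInv

/-! ## §2  The remainder as a sum of elementary steps -/

section Steps

variable (F : T4Family)

/-- **The elementary step `S_{□,Y}(x, φ) := T_Y(φ)·P_□̃·G_□(x, φ)·𝟙_□`** (non-`b₀` blocks). [cite: Balaban1985BackgroundPropagators, (3.88)–(3.90) p.409] -/
def g3cStep (Mc k K : ℕ) (TYK : (recordDomSys F Mc k K).Dom → Sect2.CPair (F.P K) (MatA 2) → FluctIdx F k K → FluctIdx F k K → ℂ)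
    (q : TPt (F.P K).d (Sect2.domCount (F.P K) Mc (k + 1))) (Y : (recordDomSys F Mc k K).Dom) (x : ℝ) (φ : Sect2.CPair (F.P K) (MatA 2)) :
    Matrix (NonB0Idx F k K) (NonB0Idx F k K) ℂ :=
  nonB0Block F k K (TYK Y φ) * g3cProj F Mc k K (g3cBlk F Mc k K q) * g3cLocInv F Mc k K TYK (g3cBlk F Mc k K q) x φ * g3cInd F Mc k K q

variable {F}
variable {a₀ δ₀ c₀ γ₀ γ₁ : ℝ} {Mc : ℕ} {α₀ α₁ ε₂₉ : ℝ} {k : ℕ}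
variable {TC : (n : ℕ) → Sect2.CPair (F.P (recordK₀ F Mc k + n)) (MatA 2) → FluctIdx F k (recordK₀ F Mc k + n) → FluctIdx F k (recordK₀ F Mc k + n) → ℂ}
variable {TY : (n : ℕ) → (recordDomSys F Mc k (recordK₀ F Mc k + n)).Dom → Sect2.CPair (F.P (recordK₀ F Mc k + n)) (MatA 2) →
  FluctIdx F k (recordK₀ F Mc k + n) → FluctIdx F k (recordK₀ F Mc k + n) → ℂ}
variable {TZY : Finset (Fin 4 → ℤ) → IntBondCfg → ((Fin 4 → ℤ) × Fin 4) × Fin 3 → ((Fin 4 → ℤ) × Fin 4) × Fin 3 → ℂ}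
variable {AdM : (n : ℕ) → (Site (F.P (recordK₀ F Mc k + n)) 0 → (MatA 2)ˣ) →
  Matrix (FluctIdx F k (recordK₀ F Mc k + n)) (FluctIdx F k (recordK₀ F Mc k + n)) ℂ}
variable {AdZ : ((Fin 4 → ℤ) → (MatA 2)ˣ) → (Fin 4 → ℤ) × Fin 4 → Matrix (Fin 3) (Fin 3) ℂ}

/-- (P4): the non-`b₀` block of the total carrier is the sum of the blocks of its pieces. [cite: Balaban1987RG1, (1.7) p.261] -/
theorem nonB0Block_eq_sum (hP : P0CarrierClauses F a₀ δ₀ c₀ γ₀ γ₁ Mc α₀ α₁ ε₂₉ k TC TY TZY AdM AdZ) (n : ℕ) (φ : Sect2.CPair (F.P (recordK₀ F Mc k + n)) (MatA 2)) :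
    nonB0Block F k (recordK₀ F Mc k + n) (TC n φ) = ∑ Y : (recordDomSys F Mc k (recordK₀ F Mc k + n)).Dom, nonB0Block F k (recordK₀ F Mc k + n) (TY n Y φ) := by
  obtain ⟨-, -, -, -, -, -, -, hSum, -⟩ := hP
  ext i j
  rw [nonB0Block, Matrix.of_apply, hSum n φ i.1 j.1, Matrix.sum_apply]
  rfl

/-- `T^{(Z)}(φ)` as a sum of non-`b₀` blocks. [cite: Balaban1987RG1, (1.7) p.261 (bookkeeping)] -/
theorem g3cLocOp_eq_sum_nonB0Block (Mc k K : ℕ) (TYK : (recordDomSys F Mc k K).Dom → Sect2.CPair (F.P K) (MatA 2) → FluctIdx F k K → FluctIdx F k K → ℂ)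
    (Z : (recordDomSys F Mc k K).Dom) (φ : Sect2.CPair (F.P K) (MatA 2)) :
    g3cLocOp F Mc k K TYK Z φ = ∑ Y ∈ (Finset.univ : Finset (recordDomSys F Mc k K).Dom).filter (fun Y => Y.1 ⊆ Z.1), nonB0Block F k K (TYK Y φ) := by
  ext i j
  rw [g3cLocOp, Matrix.of_apply, Matrix.sum_apply]
  rfl

/-- `T^{(Z)}·P_Z = T^{(Z)}` (support). [cite: Balaban1987RG1, (1.7) p.261] -/
theorem g3cLocOp_mul_proj (hP : P0CarrierClauses F a₀ δ₀ c₀ γ₀ γ₁ Mc α₀ α₁ ε₂₉ k TC TY TZY AdM AdZ) (n : ℕ)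
    (Z : (recordDomSys F Mc k (recordK₀ F Mc k + n)).Dom) (φ : Sect2.CPair (F.P (recordK₀ F Mc k + n)) (MatA 2)) :
    g3cLocOp F Mc k (recordK₀ F Mc k + n) (TY n) Z φ * g3cProj F Mc k (recordK₀ F Mc k + n) Z = g3cLocOp F Mc k (recordK₀ F Mc k + n) (TY n) Z φ := by
  ext i j
  rw [g3cProj, Matrix.mul_diagonal]
  by_cases hj : g3cInDom F Mc k (recordK₀ F Mc k + n) Z j
  · rw [if_pos hj, mul_one]
  · rw [if_neg hj, mul_zero, g3cLocOp_apply_eq_zero_right hP n Z φ i hj]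

/-- ★ **`E_□ = Σ_{Y ⊄ □̃} T_Y·P_□̃`**: the remainder of cube `□` is driven only by the pieces sticking out of its block. [cite: Balaban1985BackgroundPropagators, (3.95) p.411] -/
theorem g3cE_eq_sum (hP : P0CarrierClauses F a₀ δ₀ c₀ γ₀ γ₁ Mc α₀ α₁ ε₂₉ k TC TY TZY AdM AdZ) (n : ℕ)
    (q : TPt (F.P (recordK₀ F Mc k + n)).d (Sect2.domCount (F.P (recordK₀ F Mc k + n)) Mc (k + 1))) (x : ℝ) (φ : Sect2.CPair (F.P (recordK₀ F Mc k + n)) (MatA 2)) :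
    g3cE F Mc k (recordK₀ F Mc k + n) (TC n) (TY n) q x φ =
      ∑ Y ∈ (Finset.univ : Finset (recordDomSys F Mc k (recordK₀ F Mc k + n)).Dom).filter (fun Y => ¬ Y.1 ⊆ (g3cBlk F Mc k (recordK₀ F Mc k + n) q).1),
        nonB0Block F k (recordK₀ F Mc k + n) (TY n Y φ) * g3cProj F Mc k (recordK₀ F Mc k + n) (g3cBlk F Mc k (recordK₀ F Mc k + n) q) := by
  have hsplit := Finset.sum_filter_add_sum_filter_not (Finset.univ : Finset (recordDomSys F Mc k (recordK₀ F Mc k + n)).Dom)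
    (fun Y => Y.1 ⊆ (g3cBlk F Mc k (recordK₀ F Mc k + n) q).1) (fun Y => nonB0Block F k (recordK₀ F Mc k + n) (TY n Y φ))
  rw [g3cE, g3cAq, nonB0Block_eq_sum hP n φ, ← hsplit, ← g3cLocOp_eq_sum_nonB0Block, Matrix.add_mul, Matrix.add_mul, Matrix.smul_mul, Matrix.one_mul,
    g3cLocOp_mul_proj hP n _ φ, Finset.sum_mul]
  abel

/-- ★ **`R = Σ_□ Σ_{Y ⊄ □̃} S_{□,Y}`**. [cite: Balaban1985BackgroundPropagators, (3.88) p.409, (3.96) p.411] -/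
theorem g3cR_eq_sum_step (hP : P0CarrierClauses F a₀ δ₀ c₀ γ₀ γ₁ Mc α₀ α₁ ε₂₉ k TC TY TZY AdM AdZ) (n : ℕ) (x : ℝ) (φ : Sect2.CPair (F.P (recordK₀ F Mc k + n)) (MatA 2)) :
    g3cR F Mc k (recordK₀ F Mc k + n) (TC n) (TY n) x φ =
      ∑ q : TPt (F.P (recordK₀ F Mc k + n)).d (Sect2.domCount (F.P (recordK₀ F Mc k + n)) Mc (k + 1)),
        ∑ Y ∈ (Finset.univ : Finset (recordDomSys F Mc k (recordK₀ F Mc k + n)).Dom).filter (fun Y => ¬ Y.1 ⊆ (g3cBlk F Mc k (recordK₀ F Mc k + n) q).1),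
          g3cStep F Mc k (recordK₀ F Mc k + n) (TY n) q Y x φ := by
  rw [g3cR]
  refine Finset.sum_congr rfl fun q _ => ?_
  rw [g3cE_eq_sum hP n q x φ, Finset.sum_mul, Finset.sum_mul]
  rfl

end Steps

/-! ## §3  Operator-norm bounds of the factors; the far-step bound -/

section Norms

variable {F : T4Family}
variable {a₀ δ₀ c₀ γ₀ γ₁ : ℝ} {Mc : ℕ} {α₀ α₁ ε₂₉ : ℝ} {k : ℕ}
variable {TC : (n : ℕ) → Sect2.CPair (F.P (recordK₀ F Mc k + n)) (MatA 2) → FluctIdx F k (recordK₀ F Mc k + n) → FluctIdx F k (recordK₀ F Mc k + n) → ℂ}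
variable {TY : (n : ℕ) → (recordDomSys F Mc k (recordK₀ F Mc k + n)).Dom → Sect2.CPair (F.P (recordK₀ F Mc k + n)) (MatA 2) →
  FluctIdx F k (recordK₀ F Mc k + n) → FluctIdx F k (recordK₀ F Mc k + n) → ℂ}
variable {TZY : Finset (Fin 4 → ℤ) → IntBondCfg → ((Fin 4 → ℤ) × Fin 4) × Fin 3 → ((Fin 4 → ℤ) × Fin 4) × Fin 3 → ℂ}
variable {AdM : (n : ℕ) → (Site (F.P (recordK₀ F Mc k + n)) 0 → (MatA 2)ˣ) →
  Matrix (FluctIdx F k (recordK₀ F Mc k + n)) (FluctIdx F k (recordK₀ F Mc k + n)) ℂ}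
variable {AdZ : ((Fin 4 → ℤ) → (MatA 2)ˣ) → (Fin 4 → ℤ) × Fin 4 → Matrix (Fin 3) (Fin 3) ℂ}

/-- `‖P_Z‖ ≤ 1`. [folklore] -/
theorem l2_opNorm_g3cProj_le (Mc k K : ℕ) (Z : (recordDomSys F Mc k K).Dom) : ‖g3cProj F Mc k K Z‖ ≤ 1 :=
  G3CCT.l2_opNorm_diagonal_le _ fun i => by by_cases h : g3cInDom F Mc k K Z i <;> simp [h]

/-- `‖𝟙_□‖ ≤ 1`. [folklore] -/
theorem l2_opNorm_g3cInd_le (Mc k K : ℕ) (q : TPt (F.P K).d (Sect2.domCount (F.P K) Mc (k + 1))) : ‖g3cInd F Mc k K q‖ ≤ 1 :=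
  G3CCT.l2_opNorm_diagonal_le _ fun i => by
    by_cases h : cubeOfSite F Mc k K (blockOf i.1.1.src) = q
    · rw [if_pos h]; simp
    · rw [if_neg h]; simp

/-- ★ **`‖G_Z(x, φ)‖ ≤ 1/γ₀`** (`ℓ²`-operator norm; `x ≥ 0`, `φ` in the record space of `Z`). [cite: Balaban1985UV3, p.272 (after (63)); Balaban1985BackgroundPropagators, (3.42) p.399] -/
theorem l2_opNorm_g3cLocInv_le (hP : P0CarrierClauses F a₀ δ₀ c₀ γ₀ γ₁ Mc α₀ α₁ ε₂₉ k TC TY TZY AdM AdZ) (hγ₀ : 0 < γ₀) (n : ℕ)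
    (Z : (recordDomSys F Mc k (recordK₀ F Mc k + n)).Dom) {φ : Sect2.CPair (F.P (recordK₀ F Mc k + n)) (MatA 2)}
    (hφ : encodeCfg F (recordK₀ F Mc k + n) φ ∈ recordUc F Mc k α₀ α₁ (recordK₀ F Mc k + n) Z) {x : ℝ} (hx : 0 ≤ x) :
    ‖g3cLocInv F Mc k (recordK₀ F Mc k + n) (TY n) Z x φ‖ ≤ 1 / γ₀ := by
  rw [g3cLocInv_eq_extend]
  refine (G3CInv.l2_opNorm_extend_le _).trans ?_
  rw [g3cLocBlock]
  exact G3CCT.l2_opNorm_resolvent_le_of_reCoercive hγ₀ (g3cLocBlock_reCoercive hP n Z hφ) hx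

/-- **`‖T_Y(φ)‖ ≤ c₀e^{−δ₀d_j(Y)}`** on the non-`b₀` block (Schur test with (P4)'s row∕column sums at `φ ∈ U^c(Y)`). [cite: Balaban1987RG1, (1.18) p.263, (2.11) p.267] -/
theorem l2_opNorm_nonB0Block_TY_le (hP : P0CarrierClauses F a₀ δ₀ c₀ γ₀ γ₁ Mc α₀ α₁ ε₂₉ k TC TY TZY AdM AdZ) (hc₀ : 0 ≤ c₀) (n : ℕ)
    (Y : (recordDomSys F Mc k (recordK₀ F Mc k + n)).Dom) {φ : Sect2.CPair (F.P (recordK₀ F Mc k + n)) (MatA 2)}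
    (hφ : encodeCfg F (recordK₀ F Mc k + n) φ ∈ recordUc F Mc k α₀ α₁ (recordK₀ F Mc k + n) Y) :
    ‖nonB0Block F k (recordK₀ F Mc k + n) (TY n Y φ)‖ ≤ c₀ * Real.exp (-(δ₀ * (recordDomSys F Mc k (recordK₀ F Mc k + n)).dj Y)) := by
  obtain ⟨-, -, -, -, -, -, -, -, -, -, hAn, -⟩ := hP
  obtain ⟨-, hrow, hcol⟩ := hAn n Y φ hφ
  refine l2_opNorm_le_of_row_col_sum _ (by positivity) (fun i => ?_) (fun j => ?_)
  · refine le_trans ?_ (hrow i.1)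
    simpa only [nonB0Block, Matrix.of_apply] using
      sum_nonB0_le_sum_fluct k (recordK₀ F Mc k + n) (fun j => ‖TY n Y φ i.1 j‖) (fun _ => norm_nonneg _)
  · refine le_trans ?_ (hcol j.1)
    simpa only [nonB0Block, Matrix.of_apply] using
      sum_nonB0_le_sum_fluct k (recordK₀ F Mc k + n) (fun i => ‖TY n Y φ i j.1‖) (fun _ => norm_nonneg _)

/-- ★ **THE FAR-STEP BOUND**: `‖S_{□,Y}(x, φ)‖ ≤ c₀e^{−δ₀d_j(Y)}·γ₀⁻¹` for `x ≥ 0` and `φ` in the record spaces of `Y` and of `□̃` — NO index count (operator norms throughout).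
[cite: Balaban1985BackgroundPropagators, (3.89) p.409; Balaban1985UV3, (23) p.262] -/
theorem l2_opNorm_g3cStep_le_far (hP : P0CarrierClauses F a₀ δ₀ c₀ γ₀ γ₁ Mc α₀ α₁ ε₂₉ k TC TY TZY AdM AdZ) (hc₀ : 0 ≤ c₀) (hγ₀ : 0 < γ₀) (n : ℕ)
    (q : TPt (F.P (recordK₀ F Mc k + n)).d (Sect2.domCount (F.P (recordK₀ F Mc k + n)) Mc (k + 1))) (Y : (recordDomSys F Mc k (recordK₀ F Mc k + n)).Dom)
    {φ : Sect2.CPair (F.P (recordK₀ F Mc k + n)) (MatA 2)}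
    (hφY : encodeCfg F (recordK₀ F Mc k + n) φ ∈ recordUc F Mc k α₀ α₁ (recordK₀ F Mc k + n) Y)
    (hφq : encodeCfg F (recordK₀ F Mc k + n) φ ∈ recordUc F Mc k α₀ α₁ (recordK₀ F Mc k + n) (g3cBlk F Mc k (recordK₀ F Mc k + n) q)) {x : ℝ} (hx : 0 ≤ x) :
    ‖g3cStep F Mc k (recordK₀ F Mc k + n) (TY n) q Y x φ‖ ≤ c₀ * Real.exp (-(δ₀ * (recordDomSys F Mc k (recordK₀ F Mc k + n)).dj Y)) * (1 / γ₀) := by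
  have h1 := l2_opNorm_nonB0Block_TY_le hP hc₀ n Y hφY
  have h2 := l2_opNorm_g3cProj_le (F := F) Mc k (recordK₀ F Mc k + n) (g3cBlk F Mc k (recordK₀ F Mc k + n) q)
  have h3 := l2_opNorm_g3cLocInv_le hP hγ₀ n (g3cBlk F Mc k (recordK₀ F Mc k + n) q) hφq hx
  have h4 := l2_opNorm_g3cInd_le (F := F) Mc k (recordK₀ F Mc k + n) q
  have h0 : 0 ≤ c₀ * Real.exp (-(δ₀ * (recordDomSys F Mc k (recordK₀ F Mc k + n)).dj Y)) := by positivity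
  rw [g3cStep]
  calc ‖nonB0Block F k (recordK₀ F Mc k + n) (TY n Y φ) * g3cProj F Mc k (recordK₀ F Mc k + n) (g3cBlk F Mc k (recordK₀ F Mc k + n) q) *
        g3cLocInv F Mc k (recordK₀ F Mc k + n) (TY n) (g3cBlk F Mc k (recordK₀ F Mc k + n) q) x φ * g3cInd F Mc k (recordK₀ F Mc k + n) q‖
      ≤ ‖nonB0Block F k (recordK₀ F Mc k + n) (TY n Y φ) * g3cProj F Mc k (recordK₀ F Mc k + n) (g3cBlk F Mc k (recordK₀ F Mc k + n) q) *
          g3cLocInv F Mc k (recordK₀ F Mc k + n) (TY n) (g3cBlk F Mc k (recordK₀ F Mc k + n) q) x φ‖ * ‖g3cInd F Mc k (recordK₀ F Mc k + n) q‖ := norm_mul_le _ _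
    _ ≤ (‖nonB0Block F k (recordK₀ F Mc k + n) (TY n Y φ) * g3cProj F Mc k (recordK₀ F Mc k + n) (g3cBlk F Mc k (recordK₀ F Mc k + n) q)‖ *
          ‖g3cLocInv F Mc k (recordK₀ F Mc k + n) (TY n) (g3cBlk F Mc k (recordK₀ F Mc k + n) q) x φ‖) * 1 :=
        mul_le_mul (norm_mul_le _ _) h4 (norm_nonneg _) (by positivity)
    _ ≤ ((‖nonB0Block F k (recordK₀ F Mc k + n) (TY n Y φ)‖ * ‖g3cProj F Mc k (recordK₀ F Mc k + n) (g3cBlk F Mc k (recordK₀ F Mc k + n) q)‖) * (1 / γ₀)) * 1 := by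
        refine mul_le_mul_of_nonneg_right (mul_le_mul (norm_mul_le _ _) h3 (norm_nonneg _) (by positivity)) zero_le_one
    _ ≤ ((c₀ * Real.exp (-(δ₀ * (recordDomSys F Mc k (recordK₀ F Mc k + n)).dj Y)) * 1) * (1 / γ₀)) * 1 := by
        refine mul_le_mul_of_nonneg_right (mul_le_mul_of_nonneg_right (mul_le_mul h1 h2 (norm_nonneg _) h0) (by positivity)) zero_le_one
    _ = c₀ * Real.exp (-(δ₀ * (recordDomSys F Mc k (recordK₀ F Mc k + n)).dj Y)) * (1 / γ₀) := by ring

end Norms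

end Summit.QuantumFields.YangMills.Theorems.BalabanUVNodesPortS1

end
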